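import Literature.MathematicalPhysics.QuantumFieldTheory.Balaban1983to89.B16Sect1Wilson
import Literature.MathematicalPhysics.QuantumFieldTheory.Balaban1983to89.B16Sect1Backgrounds
import Literature.MathematicalPhysics.QuantumFieldTheory.Balaban1983to89.T4WilsonGaugeFlatDirection

/-!
# `Balaban1983to89.B16Sect1WilsonTerms` — T. Bałaban, *Large field renormalization. II. Localization, exponentiation,
and bounds for the 𝐑 operation*, Commun. Math. Phys. **122** (1989) 355–392 [Balaban1989LargeFieldII], Sect. 1
pp. 361–368: the EXPANSIONS OF THE WILSON ACTION TERMS (1.20), (1.24), (1.29), their SUMMARY (1.32), the collected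
identity (1.37), and the analytic-extension step (1.46), (1.48) — typed over the localized Wilson action `A(ζ, U)` of
`…B16Sect1Wilson` and the background vocabulary of `…B16Sect1Backgrounds`; the bookkeeping identities **(1.32)** and
**(1.37)** PROVED from the printed chain (1.14)–(1.30), with the printed `O(1)` DEFINED as *"the sum of all the small
terms obtained by the above transformations and expansions"*

statement-level skeleton of published theorems with citation tags; proofs where landed; nothing here is a claim about
the Yang–Mills mass gap

PDF held: `paper:balaban1989-cmp122-large-field-ii` (journal page = PDF page + 354); [I] = [Balaban1987RG1],
[IV] = [Balaban1989LargeFieldI], [15] = [Balaban1985Variational], [13] = [Balaban1985BackgroundPropagators],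
[12] = [Balaban1985Averaging].  Every quotation below was READ AS AN IMAGE by this seat on the x2 renders
`run/shared/lean/pub/pub-balaban/b2b-balaban-ref1/pages/1989-cmp122-large-field-II/…-p007,p008,p009,p010,p011,p014-x2.png`
(pp. 361–365, 368).

CITATION HEADER / WHAT IS REPRODUCED (mega-formalization `lit-balaban`, reader/typer r13 gen 4; HOME
`run/shared/lean/pub/lit-balaban/`, rows `lit-balaban-r13/ROWS-B16.md` v2.5): SKELETON rows **B16.Eq1.20, B16.Eq1.24,
B16.Eq1.29, B16.Eq1.32, B16.Eq1.37, B16.Eq1.46, B16.Eq1.48** (all `absent` at SKELETON v3.18: "reader-level expansion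
identities whose in-text bounds are typed as the `Txt@` rows of `…B16Sect1Statements`").

WHAT IS HERE.
* §0 — two properties of `A(ζ, U) = Σ_p ζ(p)[1 − Re tr U(∂p)]` the page uses silently: GAUGE INVARIANCE
  (`wilsonLoc_gaugeAct`, from the tree's `T4WilsonGaugeFlatDirection.plaqHol_gaugeAct` and `Re tr(hgh⁻¹) = Re tr g`) and
  LOCALITY (`wilsonLoc_eq_of_eqOn0`: `A(ζ, ·)` sees a configuration only on the bonds of the plaquettes in `supp ζ`).
* §1 — (1.20) and (1.24) as `Prop`s over the configurations of `…B16Sect1Backgrounds.Sect1Data` (the families (1.19),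
  (1.22)) with the expansion functionals of (2.8) [I] — the linear term `A ↦ ⟨DA, ζη⁻²Im ∂U⟩`, the quadratic form
  `⟨A, Δ₁(ζ)A⟩`, the remainder `V(ζ, ·)` — as EXPLICIT linear/bilinear/arbitrary maps (ref-1 F6); their first members
  (*"A(ζ, U″_{k,Z}) = A(ζ, exp iη𝐇″_{k,Z}(g_kB)U⁰_{k,Z})"*, *"A(ζ, U⁰_{k,Z}) = A(ζ, exp iη𝐇_{𝐁₁}U⁰_{𝐁₁})"*) PROVED from the
  representations (1.19), (1.22) by gauge invariance and locality; the consequence of (1.25) the page uses on p. 364,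
  `A(ζ, U⁰_{𝐁₁}) = A(ζ, U₀)`, PROVED (`wilsonLoc_bg0B1_eq`).
* §2 — (1.29): the two printed equalities PROVED as algebra over explicit data (gauge covariance of the covariant
  derivative and of `Im ∂U`, invariance of the pairing under the rotation `R(ū₀)`, adjointness `⟨DA, F⟩ = ⟨A, D*F⟩`, the
  Leibniz rule `D*(ζF) = ζD*F + (∂^{1*}ζ)-terms`, `J₀ = D*η⁻²Im ∂U₀`), each a hypothesis named as printed.
* §3 — **(1.32) PROVED** (`eq132_chain`, and `Sect1Data.eq132` on the named configurations): from (1.14), (1.15), (1.18),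
  (1.30) (tree theorems of `…B16Sect1Wilson`) and the displayed expansions (1.17), (1.20), (1.24), the p. 361 splitting
  of the quadratic form of (1.20) into (1.21) plus a small form, and (1.25), with `O(1) := O132 …` the explicit sum of
  the small terms; **(1.37) PROVED** (`eq137_chain`, `Sect1Data.eq137`) from (1.32), the p. 364 localization of its first
  term, two WEIGHT IDENTITIES proved here (`weight_p364`, `weight_zpart`: the p. 364 bottom display and the rewriting of
  the `Z`-part with `ζ`, `ζ₁`, valid because `1/(g″_k(·))² = 1/g_k²` on the layer where `0 < ζ₀ < 1` and off `Z_k ∪ Z`),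
  the (1.36)-expansion sentence and the p. 365 sentence on the first exponential, and the tree's `wilson_recombine_p365`;
  the announced CANCELLATION of `±g_k⁻²A(ζ₀, U₀)` between numerator and denominator is the visible step of the proof.
* §4 — (1.46) as a representation `Prop` over the explicit [12]-objects it names (the adjoint action `R(·)`, the
  nonlinear average `Q̃˙`, the field `𝔸₀`, the two-slot configuration `U″_{h+2}(·, V″)`), and **(1.48) PROVED** from
  (1.46), gauge invariance and a (2.8)[I]-type expansion hypothesis, with its `O(1)` the explicit sum of the expansion
  terms; the positivity sentence after (1.48) is the tree's `wilsonLoc_nonneg`.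
NOT HERE: the BOUNDS on the small terms (rows B16.Txt@361V, Txt@362, Txt@363, Lem@366, Eq1.47 of `…B16Sect1Statements`,
all typed/proved there), the random-walk expansion (1.26)–(1.27) of [13], and any claim that a small term IS small.
No `sorry`, no axiom; nothing printed is asserted as a fact: every display whose content is an expansion of [I]/[15] is
a `def … : Prop` or a hypothesis, every identity that is algebra is a theorem.
-/

open Set

namespace Literature.MathematicalPhysics.QuantumFieldTheory.Balaban1983to89.B16Sect1WilsonTerms

open B16Sect1Wilson B16Sect1Backgrounds B15DeterminingSets GaugeField

variable {P : Params}

/-! ## §0. Gauge invariance and locality of the localized Wilson action `A(ζ, U)` -/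

section Invariance

variable {j : ℕ} {G : Type*} [GaugeGroup G]

/-- `A(ζ, U^u) = A(ζ, U)`: the localized Wilson action is gauge invariant (`U^u(∂p) = u(x)U(∂p)u(x)⁻¹` and
`Re tr(hgh⁻¹) = Re tr g`) — used on p. 361 to drop `u_{k,Z}⁻¹` of (1.19) in the first equality of (1.20), on p. 362 for
`u₁⁻¹` of (1.22) in (1.24), and on p. 364 with (1.25). [cite: Balaban1989LargeFieldII, (1.20) p.361] -/
theorem wilsonLoc_gaugeAct (ζ : Plaq P j → ℝ) (u : GaugeTransf P j G) (U : GaugeField P j G) :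
    wilsonLoc ζ (gaugeAct u U) = wilsonLoc ζ U := by
  unfold wilsonLoc
  exact Finset.sum_congr rfl fun p _ => by
    rw [T4WilsonGaugeFlatDirection.plaqHol_gaugeAct, GaugeGroup.reTr_conj]

/-- `A(ζ, ·)` depends on the configuration only through the plaquette variables in `supp ζ`. [cite: Balaban1989LargeFieldII, (1.20) p.361] -/
theorem wilsonLoc_congr_support (ζ : Plaq P j → ℝ) {U U' : GaugeField P j G}
    (h : ∀ p, ζ p ≠ 0 → plaqHol U p = plaqHol U' p) : wilsonLoc ζ U = wilsonLoc ζ U' := by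
  unfold wilsonLoc
  refine Finset.sum_congr rfl fun p _ => ?_
  by_cases hp : ζ p = 0
  · rw [hp, zero_mul, zero_mul]
  · rw [h p hp]

/-- A plaquette `p` LIES IN a region `X ⊂ T^{(j)}`: its base point and the two neighbours `x + e_μ`, `x + e_ν` are in
`X` (then all four bonds of `∂p` meet `X`). [cite: Balaban1989LargeFieldII, (1.22) p.361] -/
def PlaqIn (X : Set (Site P j)) (p : Plaq P j) : Prop := p.src ∈ X ∧ p.src.shift p.μ ∈ X ∧ p.src.shift p.ν ∈ X

omit [GaugeGroup G] in
/-- Two configurations equal on the bonds meeting `X` have equal bond variables around every plaquette in `X`.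
[cite: Balaban1989LargeFieldII, (1.22) p.361] -/
theorem bond_eq_of_plaqIn {X : Set (Site P j)} {U U' : PBond P j → G} (h : ∀ b ∈ bondsOf X, U b = U' b)
    {p : Plaq P j} (hp : PlaqIn X p) :
    U ⟨p.src, p.μ⟩ = U' ⟨p.src, p.μ⟩ ∧ U ⟨p.src.shift p.μ, p.ν⟩ = U' ⟨p.src.shift p.μ, p.ν⟩ ∧
      U ⟨p.src.shift p.ν, p.μ⟩ = U' ⟨p.src.shift p.ν, p.μ⟩ ∧ U ⟨p.src, p.ν⟩ = U' ⟨p.src, p.ν⟩ :=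
  ⟨h _ (Or.inl hp.1), h _ (Or.inl hp.2.1), h _ (Or.inl hp.2.2), h _ (Or.inl hp.1)⟩

/-- LOCALITY on the fine lattice: if `U = U'` on the bonds meeting `X` (`EqOn0 X`) and `supp ζ` consists of plaquettes
in `X`, then `A(ζ, U) = A(ζ, U')` — the reading of the qualified equalities *"on this domain we have …"* (1.22) inside
`A(ζ, ·)` on p. 362. [cite: Balaban1989LargeFieldII, (1.24) p.362] -/
theorem wilsonLoc_eq_of_eqOn0 {X : Set (Site P 0)} (ζ : Plaq P 0 → ℝ) {U U' : GaugeField P 0 G}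
    (hζ : ∀ p, ζ p ≠ 0 → PlaqIn X p) (h : EqOn0 X U U') : wilsonLoc ζ U = wilsonLoc ζ U' := by
  refine wilsonLoc_congr_support ζ fun p hp => ?_
  obtain ⟨h1, h2, h3, h4⟩ := bond_eq_of_plaqIn (X := X) (fun b hb => h b hb) (hζ p hp)
  simp only [plaqHol, h1, h2, h3, h4]

end Invariance

/-! ## §1. (1.20), (1.24): the (2.8)[I]-expansions of the Wilson action around `U⁰_{k,Z}` and `U⁰_{𝐁₁}` -/

namespace Sect1Data

noncomputable section

variable {G : Type*} [GaugeGroup G] {av : ∀ i, Averaging P i G} {𝔤 : Type*} [AddCommGroup 𝔤] [Module ℝ 𝔤]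
variable (D : Sect1Data P G av 𝔤)

/-- **(1.20)** p. 361 [PDF 7], verbatim: *"side of (1.18) as in the exponential in (1.2), i.e., using (2.8) [I], we get
A(ζ, U″_{k,Z}) = A(ζ, exp iη𝐇″_{k,Z}(g_kB)U⁰_{k,Z}) = A(ζ, U⁰_{k,Z}) + g_k⟨DH″_{1,k,Z}B, ζη⁻² Im ∂U⁰_{k,Z}⟩
+ ½g_k²⟨H″_{1,k,Z}B, Δ₁(ζ)H″_{1,k,Z}B⟩ + V(ζ, g_kH″_{1,k,Z}B). (1.20)"* — for the family (1.19) `B ↦ cfg119 B` (with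
`U″_{k,Z} = cfg119 B` at the `B` of [IV] (1.81), row B16.Eq1.19) and its representing pair `(H, u)` (`Repr119`): the two
printed equalities, over the EXPLICIT expansion data of (2.8) [I] at the background `U⁰_{k,Z}` and weight `ζ` — `H1` =
the linear operator `H″_{1,k,Z}`, `L A = ⟨DA, ζη⁻²Im ∂U⁰_{k,Z}⟩` (linear), `Q A A′ = ⟨A, Δ₁(ζ)A′⟩` (bilinear), `V` = `V(ζ, ·)`
(*"at least of third order"*, not encoded). [cite: Balaban1989LargeFieldII, (1.20) p.361] -/
def Eq120 (ζ : Plaq P 0 → ℝ) (dom : Set (MSVecField P 𝔤)) (H : MSVecField P 𝔤 → VecField P 0 𝔤)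
    (H1 : MSVecField P 𝔤 →ₗ[ℝ] VecField P 0 𝔤) (L : VecField P 0 𝔤 →ₗ[ℝ] ℝ)
    (Q : VecField P 0 𝔤 →ₗ[ℝ] VecField P 0 𝔤 →ₗ[ℝ] ℝ) (V : VecField P 0 𝔤 → ℝ) : Prop :=
  ∀ B ∈ dom,
    wilsonLoc ζ (D.cfg119 B) = wilsonLoc ζ (expMul D.ch (D.η • H (D.gk • B)) D.bg0kZ) ∧
      wilsonLoc ζ (expMul D.ch (D.η • H (D.gk • B)) D.bg0kZ) =
        wilsonLoc ζ D.bg0kZ + D.gk * L (H1 B) + 1 / 2 * D.gk ^ 2 * Q (H1 B) (H1 B) + V (D.gk • H1 B)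

/-- (1.20), FIRST EQUALITY, PROVED: the representation (1.19) `cfg119 B = (exp iη𝐇″_{k,Z}(g_kB)U⁰_{k,Z})^{u_{k,Z}⁻¹}`
(`Repr119`) and gauge invariance of `A(ζ, ·)` give `A(ζ, U″_{k,Z}(…B…)) = A(ζ, exp iη𝐇″_{k,Z}(g_kB)U⁰_{k,Z})`.
[cite: Balaban1989LargeFieldII, (1.20) p.361] -/
theorem eq120_first {dom : Set (MSVecField P 𝔤)} {H : MSVecField P 𝔤 → VecField P 0 𝔤}
    {u : MSVecField P 𝔤 → GaugeTransf P 0 G} (h119 : D.Repr119 dom H u) (ζ : Plaq P 0 → ℝ)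
    {B : MSVecField P 𝔤} (hB : B ∈ dom) :
    wilsonLoc ζ (D.cfg119 B) = wilsonLoc ζ (expMul D.ch (D.η • H (D.gk • B)) D.bg0kZ) := by
  rw [h119 B hB, wilsonLoc_gaugeAct]

/-- The scaling bookkeeping inside (1.20): with `L` linear and `Q` bilinear, the (2.8)[I] terms at the field
`g_kH″_{1,k,Z}B` ARE `g_k⟨DH″_{1,k,Z}B, …⟩ + ½g_k²⟨H″_{1,k,Z}B, Δ₁(ζ)H″_{1,k,Z}B⟩` — the powers of `g_k` displayed in (1.20).
[cite: Balaban1989LargeFieldII, (1.20) p.361] -/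
theorem eq120_scaling (L : VecField P 0 𝔤 →ₗ[ℝ] ℝ) (Q : VecField P 0 𝔤 →ₗ[ℝ] VecField P 0 𝔤 →ₗ[ℝ] ℝ)
    (g : ℝ) (A : VecField P 0 𝔤) :
    L (g • A) + 1 / 2 * Q (g • A) (g • A) = g * L A + 1 / 2 * g ^ 2 * Q A A := by
  simp only [map_smul, LinearMap.smul_apply, smul_eq_mul]
  ring

/-- **(1.24)** p. 362 [PDF 8], verbatim: *"Consider the Wilson action term in (1.20). Using (1.22) we expand it with
respect to 𝐇_{𝐁₁}, as in (1.17): A(ζU⁰_{k,Z}) = A(ζ, exp iη𝐇_{𝐁₁}U⁰_{𝐁₁}) = A(ζ, U⁰_{𝐁₁}) + ⟨D𝐇_{𝐁₁}, ζη⁻² Im ∂U⁰_{𝐁₁}⟩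
+ ½⟨𝐇_{𝐁₁}, Δ(ζ)𝐇_{𝐁₁}⟩ + V₀(ζ, 𝐇_{𝐁₁}). (1.24)"* (sic: "A(ζU⁰_{k,Z})" = `A(ζ, U⁰_{k,Z})`, comma dropped in print) — over
the representing pair `(H, u)` of (1.22) (`Repr122`, the field `𝐇_{𝐁₁} = H arg122`) and explicit expansion data at the
background `U⁰_{𝐁₁}` (`bg0B1`): `L A = ⟨DA, ζη⁻²Im ∂U⁰_{𝐁₁}⟩`, `Q A A′ = ⟨A, Δ(ζ)A′⟩`, `V = V₀(ζ, ·)`.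
[cite: Balaban1989LargeFieldII, (1.24) p.362] -/
def Eq124 (ζ : Plaq P 0 → ℝ) (H : MSVecField P 𝔤 → VecField P 0 𝔤) (L : VecField P 0 𝔤 →ₗ[ℝ] ℝ)
    (Q : VecField P 0 𝔤 →ₗ[ℝ] VecField P 0 𝔤 →ₗ[ℝ] ℝ) (V : VecField P 0 𝔤 → ℝ) : Prop :=
  wilsonLoc ζ D.bg0kZ = wilsonLoc ζ (expMul D.ch (D.η • H D.arg122) D.bg0B1) ∧
    wilsonLoc ζ (expMul D.ch (D.η • H D.arg122) D.bg0B1) =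
      wilsonLoc ζ D.bg0B1 + L (H D.arg122) + 1 / 2 * Q (H D.arg122) (H D.arg122) + V (H D.arg122)

/-- (1.24), FIRST EQUALITY, PROVED: (1.22) holds ON the domain `Z ∩ Ω″˜²_{h+1}` (`Repr122`), and `supp ζ ⊂` plaquettes in
that domain (`hζ`: p. 361 *"Here we are interested only in simplest global bounds on the support of ζ"*, with `supp ζ ⊂
Z ∩ Ω″˜_{h+1}` by the construction of `ζ₀`, `ζ₁` on p. 360); locality and gauge invariance of `A(ζ, ·)` give
`A(ζ, U⁰_{k,Z}) = A(ζ, exp iη𝐇_{𝐁₁}U⁰_{𝐁₁})`. [cite: Balaban1989LargeFieldII, (1.24) p.362] -/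
theorem eq124_first {H : MSVecField P 𝔤 → VecField P 0 𝔤} {u : MSVecField P 𝔤 → GaugeTransf P 0 G}
    (h122 : D.Repr122 H u) (ζ : Plaq P 0 → ℝ) (hζ : ∀ p, ζ p ≠ 0 → PlaqIn (D.Z ∩ D.ΩppT2) p) :
    wilsonLoc ζ D.bg0kZ = wilsonLoc ζ (expMul D.ch (D.η • H D.arg122) D.bg0B1) := by
  rw [wilsonLoc_eq_of_eqOn0 ζ hζ h122, wilsonLoc_gaugeAct]

/-- The use of **(1.25)** on p. 364: on the domain `X` where `U⁰_{𝐁₁} = U₀^{ū₀}` (third member of (1.25), the tree's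
`Sect1Data.eq125`), for a weight supported in `X`, `A(ζ, U⁰_{𝐁₁}) = A(ζ, U₀)` — whence *"the Wilson action term on the
right-hand side of (1.24) … is equal to A(ζ, U₀)"* (1.30). PROVED (locality + gauge invariance).
[cite: Balaban1989LargeFieldII, (1.30) p.364] -/
theorem wilsonLoc_bg0B1_eq {X : Set (Site P 0)} {ubar : GaugeTransf P 0 G}
    (h125 : EqOn0 X D.bg0B1 (gaugeAct ubar D.U₀)) (ζ : Plaq P 0 → ℝ) (hζ : ∀ p, ζ p ≠ 0 → PlaqIn X p) :
    wilsonLoc ζ D.bg0B1 = wilsonLoc ζ D.U₀ := by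
  rw [wilsonLoc_eq_of_eqOn0 ζ hζ h125, wilsonLoc_gaugeAct]

end

end Sect1Data

/-! ## §2. (1.29): gauge covariance, adjointness and the Leibniz rule for `D*` -/

section Eq129

variable {W Pl : Type*} [AddCommGroup W] [Module ℝ W] [AddCommGroup Pl] [Module ℝ Pl]

/-- **(1.29)** p. 363 [PDF 9], verbatim: *"Thus the first order term of this expansion is small, and we have to consider
the expression (1.28) with U⁰_{k,Z} replaced by U⁰_{𝐁₁}. Using (1.25), we obtain
g_k⟨DH″_{1,k,X₀}B, ζη⁻² Im ∂U⁰_{𝐁₁}⟩ = g_k⟨H″_{1,k,X₀}R(ū₀⁻¹)B, D*ζη⁻² Im ∂U₀⟩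
= g_k⟨ζH″_{1,k,X₀}R(ū₀⁻¹)B, J₀⟩ + g_k Σ_{x,μ} η^{d−3} tr (H″_{1,k,X₀}R(ū₀⁻¹)B)_μ(x) · Σ_{ν≠μ} (∂₁^{ν*}ζ)(x)R(U₀(⟨x, x − ηe_ν⟩))
Im U₀(∂p_{νμ}(x − ηe_ν)). (1.29)"* — the DISPLAY as a `Prop` over explicit data: `W` = bond fields, `Pl` = plaquette
fields, `ipW`/`ipP` the pairings, `D'` = the covariant derivative at `U⁰_{𝐁₁}`, `Dst` = `D*` at `U₀`, `F₀ = η⁻²Im ∂U₀`,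
`F₀' = η⁻²Im ∂U⁰_{𝐁₁}`, `Rinv` = `R(ū₀⁻¹)` on bond fields, `mζW`/`mζP` = multiplication by `ζ`, `leib` = the linear map
`F ↦ Σ_{x,μ} η^{d−3} tr(·)_μ(x) Σ_{ν≠μ}(∂₁^{ν*}ζ)(x)R(U₀(⟨x,x−ηe_ν⟩))F(p_{νμ}(x−ηe_ν))` paired against the field (the second
sum, as a functional), `A = H″_{1,k,X₀}B`, `J₀ = D*F₀`. [cite: Balaban1989LargeFieldII, (1.29) p.363] -/
def Eq129 (ipW : W →ₗ[ℝ] W →ₗ[ℝ] ℝ) (ipP : Pl →ₗ[ℝ] Pl →ₗ[ℝ] ℝ) (D' : W →ₗ[ℝ] Pl) (Dst : Pl →ₗ[ℝ] W)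
    (Rinv mζW : W →ₗ[ℝ] W) (mζP : Pl →ₗ[ℝ] Pl) (leib : Pl →ₗ[ℝ] W) (F₀ F₀' : Pl) (gk : ℝ) (A : W) : Prop :=
  gk * ipP (D' A) (mζP F₀') = gk * ipW (Rinv A) (Dst (mζP F₀)) ∧
    gk * ipW (Rinv A) (Dst (mζP F₀)) = gk * ipW (mζW (Rinv A)) (Dst F₀) + gk * ipW (Rinv A) (leib F₀)

/-- **(1.29) PROVED from its printed inputs**, each a hypothesis: `hcovD` — gauge covariance of the covariant derivative,
`D_{U₀^{ū₀}}A = R(ū₀)D_{U₀}(R(ū₀⁻¹)A)` (with (1.25) `U⁰_{𝐁₁} = U₀^{ū₀}`); `hcovF` — `Im ∂(U₀^{ū₀}) = R(ū₀) Im ∂U₀`; `hRζ` — the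
rotation commutes with multiplication by the scalar `ζ`; `hRip` — the pairing is `R(ū₀)`-invariant; `hadj` — `⟨DA, F⟩ =
⟨A, D*F⟩`; `hleib` — the Leibniz rule `D*(ζF) = ζD*F + leib F`; `hζsym` — `⟨A, ζJ⟩ = ⟨ζA, J⟩`.
[cite: Balaban1989LargeFieldII, (1.29) p.363] -/
theorem eq129_of_inputs (ipW : W →ₗ[ℝ] W →ₗ[ℝ] ℝ) (ipP : Pl →ₗ[ℝ] Pl →ₗ[ℝ] ℝ) (D D' : W →ₗ[ℝ] Pl)
    (Dst : Pl →ₗ[ℝ] W) (R : Pl →ₗ[ℝ] Pl) (Rinv mζW : W →ₗ[ℝ] W) (mζP : Pl →ₗ[ℝ] Pl) (leib : Pl →ₗ[ℝ] W)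
    (F₀ F₀' : Pl) (gk : ℝ) (A : W)
    (hcovD : ∀ A, D' A = R (D (Rinv A))) (hcovF : F₀' = R F₀) (hRζ : ∀ F, mζP (R F) = R (mζP F))
    (hRip : ∀ X Y, ipP (R X) (R Y) = ipP X Y) (hadj : ∀ A F, ipP (D A) F = ipW A (Dst F))
    (hleib : ∀ F, Dst (mζP F) = mζW (Dst F) + leib F) (hζsym : ∀ A J, ipW A (mζW J) = ipW (mζW A) J) :
    Eq129 ipW ipP D' Dst Rinv mζW mζP leib F₀ F₀' gk A := by
  refine ⟨?_, ?_⟩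
  · rw [hcovD, hcovF, hRζ, hRip, hadj]
  · rw [hleib, map_add, hζsym, mul_add]

end Eq129

/-! ## §3. (1.32) and (1.37): the bookkeeping of the Wilson action terms, PROVED -/

section Summary

variable {j : ℕ} {G : Type*} [GaugeGroup G]

/-- The `O(1)` of (1.32) AS PRINTED — *"where the term O(1) denotes the sum of all the small terms obtained by the above
transformations and expansions"* — made explicit: `t17`, `t17'` = the non-leading terms of the (1.17)-expansions of
`A(ζ₀, U″_k)` and `A(1 − ζ₀, U″_k)`; `lin20`, `V20` = the linear and the `V` term of (1.20); `t21` = the small form split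
off the quadratic form of (1.20) on p. 361; `lin24`, `quad24`, `V24` = the last three terms of (1.24); and
`+g_k⁻²A(ζ₁, U₀)` from (1.30)–(1.31). [cite: Balaban1989LargeFieldII, (1.32) p.364] -/
noncomputable def O132 (gk t17 t17' lin20 V20 t21 lin24 quad24 V24 Aζ1U0 : ℝ) : ℝ :=
  -(1 / gk ^ 2) * (t17 + t17' + gk * lin20 + V20 + lin24 + 1 / 2 * quad24 + V24 - Aζ1U0) - 1 / 2 * t21

/-- **(1.32)** p. 364 [PDF 10], verbatim: *"Let us summarize the result of the above analysis of the Wilson action term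
in the effective action A″_k. We have −A(1/(g″_k(·))², U″_k) = −A(1/(g″_k(·))² − 1/g_k², U″_k) − (1/g_k²)A(1 − ζ₀,
U″_{k,Z^{∼−3}}) − (1/g_k²)A(ζ₁, U″_{k,Z}) − ½Σ_{p∈T_η} η⁴ζ(x(p))|(DH″_{1,k,Z}B)(p)|² − (1/g_k²)A(ζ₀, U₀) + O(1), (1.32) where
the term O(1) denotes the sum of all the small terms obtained by the above transformations and expansions."* — as a
`Prop` over the coupling function `c'' = 1/(g″_k(·))²` read on plaquettes, the configurations `U″_k`, `U″_{k,Z^{∼−3}}`,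
`U″_{k,Z}`, `U₀`, the value `Q121` of the form (1.21), and the number `O1`. [cite: Balaban1989LargeFieldII, (1.32) p.364] -/
def Eq132 (c'' ζ₀ ζ₁ : Plaq P j → ℝ) (gk : ℝ) (Uppk UppkZm3 UppkZ U₀ : GaugeField P j G) (Q121 O1 : ℝ) : Prop :=
  -wilsonLoc c'' Uppk =
    -wilsonLoc (fun p => c'' p - 1 / gk ^ 2) Uppk - 1 / gk ^ 2 * wilsonLoc (fun p => 1 - ζ₀ p) UppkZm3
      - 1 / gk ^ 2 * wilsonLoc ζ₁ UppkZ - 1 / 2 * Q121 - 1 / gk ^ 2 * wilsonLoc ζ₀ U₀ + O1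

/-- **(1.32) PROVED as bookkeeping.**  Inputs: the tree theorems (1.14) `eq114`, (1.15) `eq115`, (1.18) `eq118` and
(1.30) `eq130` (support proviso `hζ : ζ₀ = 1 on supp ζ₁`, `ζ = ζ₀(1 − ζ₁)`), and — as hypotheses, each a display of
the text — `h17` = (1.17) (`A(ζ₀, U″_k) = A(ζ₀, U″_{k,Z}) + t17`), `h17'` = its `1 − ζ₀` analogue of p. 360 (*"This term
is localized and expanded in the same way as in (1.16), (1.17)"*), `h20` = (1.20), `h21` = p. 361 (*"the quadratic form
in (1.20) can be written as a sum of the nonnegative form (1.21) and the small form"*), `h24` = (1.24), `h25` = (1.25)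
inside `A(ζ, ·)` (`Sect1Data.wilsonLoc_bg0B1_eq`).  Conclusion: (1.32) with `O(1) = O132 …`.
[cite: Balaban1989LargeFieldII, (1.32) p.364] -/
theorem eq132_chain (c'' ζ₀ ζ₁ : Plaq P j → ℝ) {gk : ℝ} (hgk : gk ≠ 0)
    (Uppk UppkZm3 UppkZ U0kZ U0B1 U₀ : GaugeField P j G)
    {t17 t17' lin20 quad20 V20 Q121 t21 lin24 quad24 V24 : ℝ} (hζ : ∀ p, ζ₁ p ≠ 0 → ζ₀ p = 1)
    (h17 : wilsonLoc ζ₀ Uppk = wilsonLoc ζ₀ UppkZ + t17)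
    (h17' : wilsonLoc (fun p => 1 - ζ₀ p) Uppk = wilsonLoc (fun p => 1 - ζ₀ p) UppkZm3 + t17')
    (h20 : wilsonLoc (fun p => ζ₀ p * (1 - ζ₁ p)) UppkZ =
      wilsonLoc (fun p => ζ₀ p * (1 - ζ₁ p)) U0kZ + gk * lin20 + 1 / 2 * gk ^ 2 * quad20 + V20)
    (h21 : quad20 = Q121 + t21)
    (h24 : wilsonLoc (fun p => ζ₀ p * (1 - ζ₁ p)) U0kZ =
      wilsonLoc (fun p => ζ₀ p * (1 - ζ₁ p)) U0B1 + lin24 + 1 / 2 * quad24 + V24)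
    (h25 : wilsonLoc (fun p => ζ₀ p * (1 - ζ₁ p)) U0B1 = wilsonLoc (fun p => ζ₀ p * (1 - ζ₁ p)) U₀) :
    Eq132 c'' ζ₀ ζ₁ gk Uppk UppkZm3 UppkZ U₀ Q121
      (O132 gk t17 t17' lin20 V20 t21 lin24 quad24 V24 (wilsonLoc ζ₁ U₀)) := by
  unfold Eq132 O132
  have h114 := eq114 c'' gk Uppk
  have h115 := eq115 ζ₀ Uppk
  have h118 := eq118 ζ₀ ζ₁ UppkZ hζ
  have h130 := eq130 ζ₀ ζ₁ U₀ hζ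
  rw [h114, h115, h17, h17', h118, h20, h21, h24, h25, h130]
  field_simp
  ring

/-- The p. 364 WEIGHT IDENTITY behind *"The above Wilson action term is combined together with the second term on the
right-hand side of (1.32), and the sum of these two terms is equal to −A((1/(g″_k(·))²)(1 − ζ₀), U″_{k,Z^{∼−3}})"*:
`(c″ − g_k⁻²)·𝟙_{Z_k∖Z} + g_k⁻²(1 − ζ₀) = c″(1 − ζ₀)` pointwise, PROVED under the geometry the page uses — `hζZ`: `supp ζ₀
⊂ Z`; `hlayer`: `c″ = 1/g_k²` on the plaquettes of `Z` where `ζ₀ ≠ 1` (the `∂Z` layer lies in the current small-field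
zone); `hoff`: `c″ = 1/g_k²` off `Z_k ∪ Z` (*"The first term can be written as a sum of terms localized in components of
the large field region … one is localized in Z, another in Z_k∖Z"*). [cite: Balaban1989LargeFieldII, (1.32) p.364] -/
theorem weight_p364 (c'' ζ₀ : Plaq P j → ℝ) (gk : ℝ) (Z Zk : Set (Plaq P j)) [DecidablePred (· ∈ Z)]
    [DecidablePred (· ∈ Zk)] (hζZ : ∀ p, ζ₀ p ≠ 0 → p ∈ Z) (hlayer : ∀ p ∈ Z, ζ₀ p ≠ 1 → c'' p = 1 / gk ^ 2)
    (hoff : ∀ p, p ∉ Zk → p ∉ Z → c'' p = 1 / gk ^ 2) (p : Plaq P j) :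
    (c'' p - 1 / gk ^ 2) * (if p ∈ Zk ∧ p ∉ Z then 1 else 0) + 1 / gk ^ 2 * (1 - ζ₀ p) = c'' p * (1 - ζ₀ p) := by
  by_cases hZ : p ∈ Z
  · simp only [hZ, not_true_eq_false, and_false, if_false, mul_zero, zero_add]
    by_cases h1 : ζ₀ p = 1
    · rw [h1]; ring
    · rw [hlayer p hZ h1]
  · have h0 : ζ₀ p = 0 := by
      by_contra h
      exact hZ (hζZ p h)
    by_cases hZk : p ∈ Zk
    · simp only [hZk, hZ, not_false_eq_true, and_self, if_true, h0]; ring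
    · simp only [hZk, false_and, if_false, h0, hoff p hZk hZ]; ring

/-- The same identity inside `A(·, U)`: `A((c″ − g_k⁻²)𝟙_{Z_k∖Z}, U) + g_k⁻²A(1 − ζ₀, U) = A(c″(1 − ζ₀), U)` (p. 364, the
display before (1.33)). [cite: Balaban1989LargeFieldII, (1.32) p.364] -/
theorem wilsonLoc_p364 (c'' ζ₀ : Plaq P j → ℝ) (gk : ℝ) (Z Zk : Set (Plaq P j)) [DecidablePred (· ∈ Z)]
    [DecidablePred (· ∈ Zk)] (hζZ : ∀ p, ζ₀ p ≠ 0 → p ∈ Z) (hlayer : ∀ p ∈ Z, ζ₀ p ≠ 1 → c'' p = 1 / gk ^ 2)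
    (hoff : ∀ p, p ∉ Zk → p ∉ Z → c'' p = 1 / gk ^ 2) (U : GaugeField P j G) :
    wilsonLoc (fun p => (c'' p - 1 / gk ^ 2) * (if p ∈ Zk ∧ p ∉ Z then 1 else 0)) U
        + 1 / gk ^ 2 * wilsonLoc (fun p => 1 - ζ₀ p) U = wilsonLoc (fun p => c'' p * (1 - ζ₀ p)) U := by
  rw [← wilsonLoc_smul, ← wilsonLoc_add]
  unfold wilsonLoc
  refine Finset.sum_congr rfl fun p _ => ?_
  dsimp only
  rw [weight_p364 c'' ζ₀ gk Z Zk hζZ hlayer hoff p]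

/-- The second WEIGHT IDENTITY behind (1.37): the `Z`-part of the first term of (1.32) and its third term regroup as
`A((c″ − g_k⁻²)𝟙_Z, U) + g_k⁻²A(ζ₁, U) = A((c″ − g_k⁻²)ζ, U) + A(c″ζ₁, U)` with `ζ = ζ₀(1 − ζ₁)`, PROVED under `hζ`
(`ζ₀ = 1` on `supp ζ₁`, as in (1.18)), `hζZ` and `hlayer` — the regrouping that turns the right-hand side of (1.32) into
the second and third terms of (1.37). [cite: Balaban1989LargeFieldII, (1.37) p.365] -/
theorem wilsonLoc_zpart (c'' ζ₀ ζ₁ : Plaq P j → ℝ) (gk : ℝ) (Z : Set (Plaq P j)) [DecidablePred (· ∈ Z)]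
    (hζ : ∀ p, ζ₁ p ≠ 0 → ζ₀ p = 1) (hζZ : ∀ p, ζ₀ p ≠ 0 → p ∈ Z)
    (hlayer : ∀ p ∈ Z, ζ₀ p ≠ 1 → c'' p = 1 / gk ^ 2) (U : GaugeField P j G) :
    wilsonLoc (fun p => (c'' p - 1 / gk ^ 2) * (if p ∈ Z then 1 else 0)) U + 1 / gk ^ 2 * wilsonLoc ζ₁ U =
      wilsonLoc (fun p => (c'' p - 1 / gk ^ 2) * (ζ₀ p * (1 - ζ₁ p))) U
        + wilsonLoc (fun p => c'' p * ζ₁ p) U := by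
  rw [← wilsonLoc_smul, ← wilsonLoc_add, ← wilsonLoc_add]
  unfold wilsonLoc
  refine Finset.sum_congr rfl fun p _ => ?_
  dsimp only
  congr 1
  by_cases h1 : ζ₁ p = 0
  · rw [h1]
    by_cases hZ : p ∈ Z
    · simp only [hZ, if_true]
      by_cases h0 : ζ₀ p = 1
      · rw [h0]; ring
      · rw [hlayer p hZ h0]; ring
    · have h0 : ζ₀ p = 0 := by
        by_contra h
        exact hZ (hζZ p h)
      simp only [hZ, if_false, h0]; ring
  · have h0 : ζ₀ p = 1 := hζ p h1
    have hZ : p ∈ Z := hζZ p (by rw [h0]; exact one_ne_zero)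
    simp only [hZ, if_true, h0]; ring

/-- **(1.37)** p. 365 [PDF 11], verbatim: *"All the above transformations of the Wilson action terms from all the
expressions in (1.1) yield −(1/g_k²)A(ζ₀, U_{k,Z}(V′_kV_Λ)) − A(1/(g″_k(·))², U″_k) + (1/g_k²)A(ζ₀, U₀)
= −A(1/(g_k(·))², U_k) − A((1/(g″_k(·))² − 1/g_k²)ζ, U″_{k,Z}) − A((1/(g″_k(·))²)ζ₁, U″_{k,Z})
− ½Σ_{p∈T_η} η⁴ζ(x(p))|(DH″_{1,k,Z}B)(p)|² + O(1). (1.37)"* — as a `Prop` over `c'' = 1/(g″_k(·))²`, the new coupling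
function `couplingGlue c'' gk Z` = `1/(g_k(·))²` of p. 365 (row B16.Def@365), the configurations `U_{k,Z}(V′_kV_Λ)`,
`U″_k`, `U₀`, `U_k`, `U″_{k,Z}`, the value `Q121` of (1.21) and the number `O1`. [cite: Balaban1989LargeFieldII, (1.37) p.365] -/
def Eq137 (c'' ζ₀ ζ₁ : Plaq P j → ℝ) (gk : ℝ) (Z : Set (Plaq P j)) (UkZ1 Uppk U₀ Uk UppkZ : GaugeField P j G)
    (Q121 O1 : ℝ) : Prop :=
  -(1 / gk ^ 2) * wilsonLoc ζ₀ UkZ1 - wilsonLoc c'' Uppk + 1 / gk ^ 2 * wilsonLoc ζ₀ U₀ =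
    -wilsonLoc (couplingGlue c'' gk Z) Uk
      - wilsonLoc (fun p => (c'' p - 1 / gk ^ 2) * (ζ₀ p * (1 - ζ₁ p))) UppkZ
      - wilsonLoc (fun p => c'' p * ζ₁ p) UppkZ - 1 / 2 * Q121 + O1

/-- **(1.37) PROVED from (1.32) as bookkeeping** — the announced cancellation of `±g_k⁻²A(ζ₀, U₀)` between the numerator
and the denominator (1.10) is the `abel`-visible step.  Inputs: `h32` = (1.32); `h32a` = p. 364 *"The first term can be
written as a sum of terms localized in components of the large field region … one is localized in Z, another in Z_k∖Z.
The first is transformed as in (1.17), i.e., it is written as the sum of the Wilson term −A((1/(g″_k(·))² − 1/g_k²)Z,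
U″_{k,Z}) and the remaining terms … The second part … is represented as −A((1/(g″_k(·))² − 1/g_k²)(Z_k∖Z), U″_{k,Z^{∼−3}})
plus the sum of the corresponding small terms"* (small terms `s₁`); `h36` = p. 365 after (1.36) *"we get again an
expansion of the type (1.17), with all terms small except the first one, which in this case is equal to
−A((1/(g_k(·))²)(1 − ζ₀), U_k)"* (small terms `s₂`); `h37` = p. 365 *"the Wilson action in the first exponential in (1.1),
only transformed in the same way as above, i.e., with the configuration U_{k,Z} replaced by U_k, and with some new small
terms"* (`s₃`); the weight identities `wilsonLoc_p364`, `wilsonLoc_zpart` (hypotheses `hζ`, `hζZ`, `hlayer`, `hoff`) and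
the tree's p. 365 recombination `wilson_recombine_p365`.  Conclusion: (1.37) with `O(1) = O1 + s₁ − s₂ − s₃/g_k²`.
[cite: Balaban1989LargeFieldII, (1.37) p.365] -/
theorem eq137_chain (c'' ζ₀ ζ₁ : Plaq P j → ℝ) (gk : ℝ) (Z Zk : Set (Plaq P j)) [DecidablePred (· ∈ Z)]
    [DecidablePred (· ∈ Zk)] (UkZ1 Uppk UppkZm3 UppkZ U₀ Uk : GaugeField P j G) {Q121 O1 s₁ s₂ s₃ : ℝ}
    (hζ : ∀ p, ζ₁ p ≠ 0 → ζ₀ p = 1) (hζZ : ∀ p, ζ₀ p ≠ 0 → p ∈ Z)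
    (hlayer : ∀ p ∈ Z, ζ₀ p ≠ 1 → c'' p = 1 / gk ^ 2) (hoff : ∀ p, p ∉ Zk → p ∉ Z → c'' p = 1 / gk ^ 2)
    (h32 : Eq132 c'' ζ₀ ζ₁ gk Uppk UppkZm3 UppkZ U₀ Q121 O1)
    (h32a : -wilsonLoc (fun p => c'' p - 1 / gk ^ 2) Uppk =
      -wilsonLoc (fun p => (c'' p - 1 / gk ^ 2) * (if p ∈ Z then 1 else 0)) UppkZ
        - wilsonLoc (fun p => (c'' p - 1 / gk ^ 2) * (if p ∈ Zk ∧ p ∉ Z then 1 else 0)) UppkZm3 + s₁)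
    (h36 : -wilsonLoc (fun p => c'' p * (1 - ζ₀ p)) UppkZm3 =
      -wilsonLoc (fun p => couplingGlue c'' gk Z p * (1 - ζ₀ p)) Uk + s₂)
    (h37 : -(1 / gk ^ 2) * wilsonLoc ζ₀ UkZ1 = -(1 / gk ^ 2) * wilsonLoc ζ₀ Uk + s₃) :
    Eq137 c'' ζ₀ ζ₁ gk Z UkZ1 Uppk U₀ Uk UppkZ Q121 (O1 + s₁ + s₂ + s₃) := by
  unfold Eq137
  unfold Eq132 at h32
  have hrec := wilson_recombine_p365 c'' gk Z ζ₀ Uk hζZ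
  have hp364 := wilsonLoc_p364 c'' ζ₀ gk Z Zk hζZ hlayer hoff UppkZm3
  have hz := wilsonLoc_zpart c'' ζ₀ ζ₁ gk Z hζ hζZ hlayer UppkZ
  linear_combination h32 + h32a - hp364 + h36 + h37 - hrec - hz

end Summary

/-! ### (1.32), (1.37) on the named configurations of Sect. 1 -/

namespace Sect1Data

noncomputable section

variable {G : Type*} [GaugeGroup G] {av : ∀ i, Averaging P i G} {𝔤 : Type*} [AddCommGroup 𝔤] [Module ℝ 𝔤]
variable (D : Sect1Data P G av 𝔤)

/-- `U_{k,Z}(V′_kV_Λ)` — the configuration of the first exponential of (1.1) p. 356, *"exp[−(1/g_k²)A(ζ₀, U_{k,Z}(V′_kV_Λ))]"*: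
the [IV] (1.74) map `U_{k,Z}(·) = U(𝐁_k(Z), M˙(Q_k^{s*}·))` (`B15DeterminingSets.bgKZ`) at the scale-`k` field `V′_kV_Λ`.
[cite: Balaban1989LargeFieldII, (1.1) p.356] -/
def cfgKZ11 : GaugeField P 0 G := bgKZ D.bg D.detKZ D.Qs (mulCfg (D.Vk' D.k) (D.VΛ D.k))

/-- **(1.32) on the Sect. 1 configurations** (`U″_k = cfgPP`, `U″_{k,Z^{∼−3}} = cfgPPZm3`, `U″_{k,Z} = cfgPPZ`, `U⁰_{k,Z} =
bg0kZ`, `U⁰_{𝐁₁} = bg0B1`, `U₀`): PROVED from the same displayed inputs as `eq132_chain`, with (1.25) entering through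
`wilsonLoc_bg0B1_eq` (its third member on a domain `X` containing the plaquettes of `supp ζ`).
[cite: Balaban1989LargeFieldII, (1.32) p.364] -/
theorem eq132 (c'' ζ₀ ζ₁ : Plaq P 0 → ℝ) (hgk : D.gk ≠ 0)
    {t17 t17' lin20 quad20 V20 Q121 t21 lin24 quad24 V24 : ℝ} (hζ : ∀ p, ζ₁ p ≠ 0 → ζ₀ p = 1)
    {X : Set (Site P 0)} {ubar : GaugeTransf P 0 G} (h125 : EqOn0 X D.bg0B1 (gaugeAct ubar D.U₀))
    (hζX : ∀ p, ζ₀ p * (1 - ζ₁ p) ≠ 0 → PlaqIn X p)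
    (h17 : wilsonLoc ζ₀ D.cfgPP = wilsonLoc ζ₀ D.cfgPPZ + t17)
    (h17' : wilsonLoc (fun p => 1 - ζ₀ p) D.cfgPP = wilsonLoc (fun p => 1 - ζ₀ p) D.cfgPPZm3 + t17')
    (h20 : wilsonLoc (fun p => ζ₀ p * (1 - ζ₁ p)) D.cfgPPZ =
      wilsonLoc (fun p => ζ₀ p * (1 - ζ₁ p)) D.bg0kZ + D.gk * lin20 + 1 / 2 * D.gk ^ 2 * quad20 + V20)
    (h21 : quad20 = Q121 + t21)
    (h24 : wilsonLoc (fun p => ζ₀ p * (1 - ζ₁ p)) D.bg0kZ =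
      wilsonLoc (fun p => ζ₀ p * (1 - ζ₁ p)) D.bg0B1 + lin24 + 1 / 2 * quad24 + V24) :
    Eq132 c'' ζ₀ ζ₁ D.gk D.cfgPP D.cfgPPZm3 D.cfgPPZ D.U₀ Q121
      (O132 D.gk t17 t17' lin20 V20 t21 lin24 quad24 V24 (wilsonLoc ζ₁ D.U₀)) :=
  eq132_chain c'' ζ₀ ζ₁ hgk D.cfgPP D.cfgPPZm3 D.cfgPPZ D.bg0kZ D.bg0B1 D.U₀ hζ h17 h17' h20 h21 h24
    (wilsonLoc_bg0B1_eq D h125 _ hζX)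

/-- **(1.37) on the Sect. 1 configurations** (`U_{k,Z}(V′_kV_Λ) = cfgKZ11`, `U″_k = cfgPP`, `U₀`, `U_k = cfgK135` of
(1.35), `U″_{k,Z} = cfgPPZ`, `U″_{k,Z^{∼−3}} = cfgPPZm3`): PROVED from (1.32) and the p. 364–365 inputs as in `eq137_chain`
(`Z`, `Zk` = the plaquette sets of the regions `Z`, `Z_k`). [cite: Balaban1989LargeFieldII, (1.37) p.365] -/
theorem eq137 (c'' ζ₀ ζ₁ : Plaq P 0 → ℝ) (Z Zk : Set (Plaq P 0)) [DecidablePred (· ∈ Z)]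
    [DecidablePred (· ∈ Zk)] {Q121 O1 s₁ s₂ s₃ : ℝ} (hζ : ∀ p, ζ₁ p ≠ 0 → ζ₀ p = 1)
    (hζZ : ∀ p, ζ₀ p ≠ 0 → p ∈ Z) (hlayer : ∀ p ∈ Z, ζ₀ p ≠ 1 → c'' p = 1 / D.gk ^ 2)
    (hoff : ∀ p, p ∉ Zk → p ∉ Z → c'' p = 1 / D.gk ^ 2)
    (h32 : Eq132 c'' ζ₀ ζ₁ D.gk D.cfgPP D.cfgPPZm3 D.cfgPPZ D.U₀ Q121 O1)
    (h32a : -wilsonLoc (fun p => c'' p - 1 / D.gk ^ 2) D.cfgPP =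
      -wilsonLoc (fun p => (c'' p - 1 / D.gk ^ 2) * (if p ∈ Z then 1 else 0)) D.cfgPPZ
        - wilsonLoc (fun p => (c'' p - 1 / D.gk ^ 2) * (if p ∈ Zk ∧ p ∉ Z then 1 else 0)) D.cfgPPZm3 + s₁)
    (h36 : -wilsonLoc (fun p => c'' p * (1 - ζ₀ p)) D.cfgPPZm3 =
      -wilsonLoc (fun p => couplingGlue c'' D.gk Z p * (1 - ζ₀ p)) D.cfgK135 + s₂)
    (h37 : -(1 / D.gk ^ 2) * wilsonLoc ζ₀ (cfgKZ11 D) = -(1 / D.gk ^ 2) * wilsonLoc ζ₀ D.cfgK135 + s₃) :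
    Eq137 c'' ζ₀ ζ₁ D.gk Z (cfgKZ11 D) D.cfgPP D.U₀ D.cfgK135 D.cfgPPZ Q121 (O1 + s₁ + s₂ + s₃) :=
  eq137_chain c'' ζ₀ ζ₁ D.gk Z Zk (cfgKZ11 D) D.cfgPP D.cfgPPZm3 D.cfgPPZ D.U₀ D.cfgK135 hζ hζZ hlayer hoff h32
    h32a h36 h37

end

end Sect1Data

/-! ## §4. (1.46) and (1.48): the analytic extension as a small perturbation of a positive Wilson action -/

namespace Sect1Data

noncomputable section

variable {G : Type*} [GaugeGroup G] {av : ∀ i, Averaging P i G} {𝔤 : Type*} [AddCommGroup 𝔤] [Module ℝ 𝔤]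
variable (D : Sect1Data P G av 𝔤)

/-- Bondwise conjugation `X ↦ V X V⁻¹` of multi-scale data — the group-level `R(exp ig_kB)(·)` of (1.46): the datum
`V′V₀ = exp ig_kB exp iQ̃˙(η𝔸₀)` is written `[R(exp ig_kB) exp iQ̃˙(η𝔸₀)] exp ig_kB`. [cite: Balaban1989LargeFieldII, (1.46) p.368] -/
def msConj (V X : MSField P G) : MSField P G := fun i b => V i b * X i b * (V i b)⁻¹

/-- `[V X V⁻¹]·V = V·X`: the rewriting of the datum `exp ig_kB exp iQ̃˙(η𝔸₀)` used in (1.46) is an identity (bondwise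
group law). [cite: Balaban1989LargeFieldII, (1.46) p.368] -/
theorem msMul_msConj (V X : MSField P G) : msMul (msConj V X) V = msMul V X := by
  funext i b
  simp [msMul, msConj, mulCfg, mul_assoc]

/-- The adjoint action read in the chart, scale-wise: `(R(exp iB)𝔸)(b) = Ad(exp iB(b)) 𝔸(b)` — the Lie-algebra-level
`R(exp ig_kB)Q̃˙(η𝔸₀)` in the argument of `𝐇″_{h+2}` in (1.46) (`Ad : G → 𝔤 →ₗ 𝔤` the adjoint representation, an
explicit argument: the matrix model is not fixed, `Setup` DIVERGENCE F4). [cite: Balaban1989LargeFieldII, (1.46) p.368] -/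
def msAd (Ad : G → 𝔤 →ₗ[ℝ] 𝔤) (B 𝔸 : MSVecField P 𝔤) : MSVecField P 𝔤 := fun i b => Ad (D.ch.iexp (B i b)) (𝔸 i b)

/-- `U″_{h+2}(W, V″)` — p. 368, verbatim: *"The configuration U″_{k,Z″_{h+2}} depends on the field V′V₀ = exp ig_kB
exp iQ̃˙(η𝔸₀) on Ω″˜²_{h+1}∩Z″_{h+2}, and on the field V″ on (Ω″˜²_{h+1})ᶜ. … Denote for simplicity the above configuration
by U″_{h+2}"* — the two-slot configuration `U(𝐁″_k(Z″_{h+2}), (W↾_{Ω″˜²_{h+1}∩Z″_{h+2}}, V″↾))` over the explicit localized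
determining set `detPPZh2 = 𝐁″_k(Z″_{h+2})` and region `Zpph2 = Z″_{h+2}`. [cite: Balaban1989LargeFieldII, (1.46) p.368] -/
def cfgH2 (detPPZh2 : DetSet P) (Zpph2 : Set (Site P 0)) (W : MSField P G) : GaugeField P 0 G :=
  D.bg.U detPPZh2 (splice (D.ΩppT2 ∩ Zpph2) W D.Vpp)

/-- `exp ig_kB` as multi-scale data (the second slot of `U″_{h+2}(exp ig_kB, V″)` in (1.46)). [cite: Balaban1989LargeFieldII, (1.46) p.368] -/
def expB146 (B : MSVecField P 𝔤) : MSField P G := msExpMul D.ch (D.gk • B) 1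

/-- The argument `R(exp ig_kB)Q̃˙(η𝔸₀)` of `𝐇″_{h+2}` in (1.46), over the explicit adjoint action `Ad` and nonlinear
multi-scale average `Qt` = `Q̃˙` of [12] (26). [cite: Balaban1989LargeFieldII, (1.46) p.368] -/
def arg146 (Ad : G → 𝔤 →ₗ[ℝ] 𝔤) (Qt : VecField P 0 𝔤 → MSVecField P 𝔤) (𝔸₀ : VecField P 0 𝔤)
    (B : MSVecField P 𝔤) : MSVecField P 𝔤 :=
  msAd D Ad (D.gk • B) (Qt (D.η • 𝔸₀))

/-- The complex datum of (1.46), `[R(exp ig_kB) exp iQ̃˙(η𝔸₀)] exp ig_kB` (`= exp ig_kB · exp iQ̃˙(η𝔸₀)`, `msMul_msConj`).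
[cite: Balaban1989LargeFieldII, (1.46) p.368] -/
def datum146 (Qt : VecField P 0 𝔤 → MSVecField P 𝔤) (𝔸₀ : VecField P 0 𝔤) (B : MSVecField P 𝔤) : MSField P G :=
  msMul (msConj (expB146 D B) (msExpMul D.ch (Qt (D.η • 𝔸₀)) 1)) (expB146 D B)

/-- **(1.46)** p. 368 [PDF 14], verbatim: *"It is an analytic function of 𝔸₀, hence of 𝐔, and we have the expansion
U″_{h+2}([R(exp ig_kB) exp iQ̃˙(η𝔸₀)] exp ig_kB, V″) = (exp iη𝐇″_{h+2}(R(exp ig_kB)Q̃˙(η𝔸₀))U″_{h+2}(exp ig_kB, V″))^{u″_{h+2}⁻¹}.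
(1.46) The argument of the function 𝐇″_{h+2} has a support in the domain Ω″˜²_{h+1}∩Z″_{h+2}."* — over the explicit objects
`Ad` (adjoint action), `Qt` = the nonlinear multi-scale average `Q̃˙` of [12] (26), `𝔸₀` of [IV] (1.86) extended to `𝐔`,
the chart field `B`, and the representing pair (`H` = `𝐇″_{h+2}`, `u` = `u″_{h+2}`). [cite: Balaban1989LargeFieldII, (1.46) p.368] -/
def Repr146 (detPPZh2 : DetSet P) (Zpph2 : Set (Site P 0)) (Ad : G → 𝔤 →ₗ[ℝ] 𝔤)
    (Qt : VecField P 0 𝔤 → MSVecField P 𝔤) (𝔸₀ : VecField P 0 𝔤) (B : MSVecField P 𝔤)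
    (H : MSVecField P 𝔤 → VecField P 0 𝔤) (u : MSVecField P 𝔤 → GaugeTransf P 0 G) : Prop :=
  cfgH2 D detPPZh2 Zpph2 (datum146 D Qt 𝔸₀ B) =
    gaugeAct (invG (u (arg146 D Ad Qt 𝔸₀ B)))
      (expMul D.ch (D.η • H (arg146 D Ad Qt 𝔸₀ B)) (cfgH2 D detPPZh2 Zpph2 (expB146 D B)))

/-- **(1.48)** p. 368 [PDF 14], verbatim: *"The last bound above is small under the usual conditions on N. Bounds for the
other terms in the expansion are similar. Thus we have A((1/(g″_k(·))²)ζ₁, U″_{h+2}(𝐔)) = A((1/(g″_k(·))²)ζ₁, U″_{h+2}(exp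
ig_kB, V″)) + O(1), (1.48) where the terms in O(1) are small, and depend analytically on the field 𝐔 restricted to the
domain Z."* — as a `Prop` over the two configurations and the number `O1` (`w = (1/(g″_k(·))²)ζ₁` on plaquettes).
[cite: Balaban1989LargeFieldII, (1.48) p.368] -/
def Eq148 (w : Plaq P 0 → ℝ) (Ucplx Ureal : GaugeField P 0 G) (O1 : ℝ) : Prop :=
  wilsonLoc w Ucplx = wilsonLoc w Ureal + O1

/-- **(1.48) PROVED from (1.46)**: with `Repr146` and the sentence *"The above expansion yields the usual expansion of the
Wilson action, i.e., the expansion of the form (1.17)"* as the hypothesis `hexp` (a (2.8)[I]-type expansion of `A(w, ·)`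
around `U″_{h+2}(exp ig_kB, V″)` in the field `𝐇″_{h+2}(arg)`, terms `L`, `Q`, `V`), gauge invariance removes `u″_{h+2}⁻¹`
and (1.48) holds with `O(1) = L + ½Q + V` — the explicit *"terms in O(1)"*.  The sentence *"The gauge field in the Wilson
action on the right-hand side is G-valued, hence the action is positive"* is `B16Sect1Wilson.wilsonLoc_nonneg`.
[cite: Balaban1989LargeFieldII, (1.48) p.368] -/
theorem eq148_of_repr146 {detPPZh2 : DetSet P} {Zpph2 : Set (Site P 0)} {Ad : G → 𝔤 →ₗ[ℝ] 𝔤}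
    {Qt : VecField P 0 𝔤 → MSVecField P 𝔤} {𝔸₀ : VecField P 0 𝔤} {B : MSVecField P 𝔤}
    {H : MSVecField P 𝔤 → VecField P 0 𝔤} {u : MSVecField P 𝔤 → GaugeTransf P 0 G}
    (h146 : Repr146 D detPPZh2 Zpph2 Ad Qt 𝔸₀ B H u) (w : Plaq P 0 → ℝ) {L Q V : ℝ}
    (hexp : wilsonLoc w (expMul D.ch (D.η • H (arg146 D Ad Qt 𝔸₀ B)) (cfgH2 D detPPZh2 Zpph2 (expB146 D B))) =
      wilsonLoc w (cfgH2 D detPPZh2 Zpph2 (expB146 D B)) + L + 1 / 2 * Q + V) :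
    Eq148 w (cfgH2 D detPPZh2 Zpph2 (datum146 D Qt 𝔸₀ B)) (cfgH2 D detPPZh2 Zpph2 (expB146 D B))
      (L + 1 / 2 * Q + V) := by
  have h1 : cfgH2 D detPPZh2 Zpph2 (datum146 D Qt 𝔸₀ B) = _ := h146
  unfold Eq148
  rw [h1, wilsonLoc_gaugeAct, hexp]
  ring

/-- The main term of (1.48) is nonnegative for a nonnegative weight `(1/(g″_k(·))²)ζ₁` — *"hence the action is positive,
and it provides the necessary bounds for large plaquette variables"* (row B16.Eq1.48 positivity clause; the tree's
`wilsonLoc_nonneg`). [cite: Balaban1989LargeFieldII, (1.48) p.368] -/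
theorem eq148_main_nonneg {detPPZh2 : DetSet P} {Zpph2 : Set (Site P 0)} (w : Plaq P 0 → ℝ) (hw : ∀ p, 0 ≤ w p)
    (W : MSField P G) : 0 ≤ wilsonLoc w (cfgH2 D detPPZh2 Zpph2 W) :=
  wilsonLoc_nonneg w _ hw

end

end Sect1Data

end Literature.MathematicalPhysics.QuantumFieldTheory.Balaban1983to89.B16Sect1WilsonTerms
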